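import Mathlib
import HarnessLib
import Literature.Analysis.FluidPDE.TaoEnstrophyLocalisation
import Literature.Analysis.FluidPDE.BarkerPrange2020VorticityAlignmentTypeIHolds
import Summits.NavierStokesRegularity.NavierStokesRegularity.Theorems.PoloidalWindowDoorPoloidalWindowRigidityWindow
import Summits.NavierStokesRegularity.NavierStokesRegularity.Theorems.PoloidalWindowDoorPoloidalWindowRigidityStructureFunction
import Summits.NavierStokesRegularity.NavierStokesRegularity.Theorems.PoloidalWindowDoorPoloidalWindowRigidityLeafUniformVortexLine
import Summits.NavierStokesRegularity.NavierStokesRegularity.Theorems.PoloidalWindowDoorPoloidalWindowRigidityLeafUniformAloneCore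

/-!
# Route `PoloidalWindowDoor`, crux `PoloidalWindowRigidity` (stmt-NavierStokesRegularity-19708) — LINE 18 «leaf_uniform» v1.3.1
# / LINE 20 «hot_forest» v1.1 (ns-idea-8; critic idea-crit-7 PASS): support R18 `HotRegularAlone`, VERBATIM
# (Cruxes-local `Pinned` / `hotSet` unfolded)

Seat ns-es-p1 g7 (free prover hand; R18 was «L, unowned»; CLAIM announced on the ideators / ns-regularity-ideate buses before
proposing).

* `hotRegularAlone` (R18 `HotRegularAlone`): for a pinned class profile with the frozen law whose hot set
  `H = {y₂ = 0, v₂(−1,y) = N}` has empty interior in the plane `P₀`, every REGULAR hot point `y` (`ω(−1,y) ≠ 0`) has a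
  neighbourhood in which the hot set is contained in ONE vortex arc through `y`.

PROOF (no flow box): the tree's Clebsch potential `ψ` of the poloidal class (`ωₕ = (∂₁ψ, −∂₀ψ)`,
`…Clebsch` via `…StructureFunction.exists_clebsch_structureFunction`) is a first integral of `ω(−1,·)` and carries the local
STRUCTURE FUNCTION `v₂(−1,x) = F(−1, ψ(−1,x), x₂)` near `y`; the slice is real-analytic
(`IsTypeIAncientMild.analyticOnNhd_slice_univ`), so `σ ↦ v₂(−1, y + σ∇ₕψ(y))` is analytic, and it is not locally constant
(else a plane neighbourhood of `y` would be hot: strict monotonicity of `σ ↦ ψ(y + σ∇ₕψ(y))`, IVT, continuity of `ψ`), so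
`σ = 0` is isolated in its `N`-level set (`AnalyticAt.eventually_eq_or_eventually_ne`); hence hot points near `y` have
`ψ = ψ(y)`; the global vortex line through `y` (ns-poloidal-K2-p2 g13's `…LeafUniformVortexLine.vortexLineGlobal`, by name)
carries `ψ` and `x₂` as first integrals, its tangential frame coordinate is strictly increasing near `0`, and the normal
coordinate of a point with `ψ = ψ(y)` is forced (`∂_Nψ > 0` on a square) — `…LeafUniformAloneCore.alone_core`.

HONEST LABEL: ONE support stub (L) of two registered lines; it closes no cell, no crux and no route item; the research cells,
C2a′ / C2b′ / S0, 19708 / 20428 and NS regularity stay OPEN — no summit statement is proved here.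
-/

noncomputable section

-- the summit and its single sub-problem share the name (CONVENTIONS §1), as in every Theorems file
set_option linter.dupNamespace false

namespace Summit.NavierStokesRegularity.NavierStokesRegularity.Theorems.PoloidalWindowDoorPoloidalWindowRigidityLeafUniformHotRegularAlone

open Set Function Filter Topology Metric
open scoped InnerProductSpace RealInnerProductSpace Laplacian NNReal
open Literature.Analysis Literature.Analysis.FluidPDE
open Summit.NavierStokesRegularity.NavierStokesRegularity.Theorems.PoloidalWindowDoorPoloidalWindowRigidityWindow
open Summit.NavierStokesRegularity.NavierStokesRegularity.Theorems.PoloidalWindowDoorPoloidalWindowRigidityStructureFunction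
open Summit.NavierStokesRegularity.NavierStokesRegularity.Theorems.PoloidalWindowDoorPoloidalWindowRigidityLeafUniformVortexLine
open Summit.NavierStokesRegularity.NavierStokesRegularity.Theorems.PoloidalWindowDoorPoloidalWindowRigidityLeafUniformAloneCore

/-! ## R18 — near a regular hot point the hot set is one vortex arc -/

/-- **R18 `HotRegularAlone` (VERBATIM, `Pinned` / `hotSet` unfolded).**  See the module docstring. -/
theorem hotRegularAlone :
    ∀ (C : ℝ) (v : ℝ → EuclideanSpace ℝ (Fin 3) → EuclideanSpace ℝ (Fin 3)),
      (Literature.Analysis.FluidPDE.HasTypeITimeDecay C v ∧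
        ContinuousOn (Function.uncurry v) (Set.Iio (0 : ℝ) ×ˢ Set.univ) ∧
        (∀ s t : ℝ, s < t → t < 0 → ∀ x, v t x =
          Literature.Analysis.UnboundedOperators.heatExtension (v s) (t - s) x -
            Literature.Analysis.FluidPDE.oseenDuhamel 1 s v v t x) ∧
        (∀ t < 0, Literature.Analysis.FluidPDE.VectorCalculus.IsDivFree (v t)) ∧
        (∀ s < 0, ∀ y, ⟪Literature.Analysis.FluidPDE.curl (v s) y, EuclideanSpace.single 2 1⟫_ℝ = 0) ∧
        v (-1) 0 2 ≠ 0 ∧ (∀ t < 0, ∀ x, Real.sqrt (-t) * |v t x 2| ≤ |v (-1) 0 2|) ∧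
        (∀ h : EuclideanSpace ℝ (Fin 3), fderiv ℝ (v (-1)) 0 h 2 = 0) ∧
        (deriv (fun s => v s 0 2) (-1) = v (-1) 0 2 / 2 ∧ v (-1) 0 2 * (Δ (fun y => v (-1) y 2)) 0 ≤ 0)) →
      (∀ s < 0, ∀ y, ⟪fderiv ℝ (v s) y (Literature.Analysis.FluidPDE.curl (v s) y), EuclideanSpace.single 2 1⟫_ℝ = 0) →
      (∀ y ∈ {y : EuclideanSpace ℝ (Fin 3) | y 2 = 0 ∧ v (-1) y 2 = v (-1) 0 2}, ∀ r : ℝ, 0 < r →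
        ∃ y' : EuclideanSpace ℝ (Fin 3), y' 2 = 0 ∧ dist y' y < r ∧ v (-1) y' 2 ≠ v (-1) 0 2) →
      (∀ y ∈ {y : EuclideanSpace ℝ (Fin 3) | y 2 = 0 ∧ v (-1) y 2 = v (-1) 0 2},
        Literature.Analysis.FluidPDE.curl (v (-1)) y ≠ 0 → ∃ r : ℝ, 0 < r ∧
          ∃ (α : ℝ → EuclideanSpace ℝ (Fin 3)) (δ : ℝ), 0 < δ ∧ α 0 = y ∧
            (∀ s ∈ Set.Ioo (-δ) δ, HasDerivAt α (Literature.Analysis.FluidPDE.curl (v (-1)) (α s)) s) ∧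
            ∀ y' ∈ {y : EuclideanSpace ℝ (Fin 3) | y 2 = 0 ∧ v (-1) y 2 = v (-1) 0 2}, dist y' y < r →
              ∃ s ∈ Set.Ioo (-δ) δ, y' = α s) := by
  intro C v hP hfrozen hNoInt y hy hωy
  have hP' := hP
  obtain ⟨hTI, hcont, hmild, hdiv, hpol, -, -, -, -⟩ := hP'
  obtain ⟨hy2, hyN⟩ : y 2 = 0 ∧ v (-1) y 2 = v (-1) 0 2 := hy
  -- the class: analytic slice, continuous vorticity
  have hclass : IsTypeIAncientMild C v := isTypeIAncientMild_of_class hTI hcont hmild hdiv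
  have hvinf : ContDiff ℝ ((⊤ : ℕ∞) : WithTop ℕ∞) (v (-1)) := hclass.contDiff_slice (by norm_num)
  have hωc : Continuous (curl (v (-1))) := by
    rw [curl_eq_curlCLM_comp]
    exact curlCLM.continuous.comp (hvinf.continuous_fderiv (by simp))
  have hwan : ∀ x, AnalyticAt ℝ (fun x => v (-1) x 2) x := fun x =>
    ((EuclideanSpace.proj (2 : Fin 3) : EuclideanSpace ℝ (Fin 3) →L[ℝ] ℝ).analyticAt _).comp
      (hclass.analyticOnNhd_slice_univ (by norm_num) x (mem_univ _))
  -- the Clebsch potential and the structure function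
  obtain ⟨φ, ψ, -, hψs, hsl, hstructF⟩ := exists_clebsch_structureFunction hTI hcont hmild hdiv hpol
  have hψ1 : ContDiff ℝ 1 (ψ (-1)) := by
    have h : ContDiff ℝ ((⊤ : ℕ∞) : WithTop ℕ∞) (ψ (-1)) :=
      hψs.comp_contDiff (contDiff_prodMk_right (-1 : ℝ)) fun x => mk_mem_prod (mem_Iio.2 (by norm_num)) (mem_univ x)
    exact contDiff_infty.1 h 1
  have hcurl := (hsl (-1) (by norm_num)).2.2.1
  have hgrad : ∀ x, fderiv ℝ (ψ (-1)) x (EuclideanSpace.single 0 1) = -(curl (v (-1)) x 1) ∧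
      fderiv ℝ (ψ (-1)) x (EuclideanSpace.single 1 1) = curl (v (-1)) x 0 := fun x =>
    ⟨by rw [(hcurl x).2.1, neg_neg], (hcurl x).1.symm⟩
  have hω2 : ∀ x, curl (v (-1)) x 2 = 0 := fun x => (hcurl x).2.2
  obtain ⟨F, -, hF⟩ := hstructF (-1) (by norm_num) y hωy
  have hstruct : ∃ ρ > 0, ∃ G : ℝ → ℝ, ∀ x : EuclideanSpace ℝ (Fin 3), x 2 = 0 → dist x y < ρ →
      (fun x => v (-1) x 2) x = G (ψ (-1) x) := by
    obtain ⟨ρ, hρ, hF'⟩ := Metric.eventually_nhds_iff.1 hF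
    refine ⟨ρ, hρ, fun c => F (-1, c, 0), fun x hx2 hxd => ?_⟩
    have hz : dist ((-1 : ℝ), x) ((-1 : ℝ), y) < ρ := by
      rw [Prod.dist_eq, dist_self, max_eq_right dist_nonneg]; exact hxd
    have h := hF' hz
    simp only at h
    show v (-1) x 2 = F (-1, ψ (-1) x, 0)
    rw [h, hx2]
  have hNoInt' : ∀ r > 0, ∃ x : EuclideanSpace ℝ (Fin 3), x 2 = 0 ∧ dist x y < r ∧
      (fun x => v (-1) x 2) x ≠ (fun x => v (-1) x 2) y := by
    intro r hr
    obtain ⟨x, hx2, hxd, hxw⟩ := hNoInt y ⟨hy2, hyN⟩ r hr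
    exact ⟨x, hx2, hxd, by simp only [hyN]; exact hxw⟩
  -- the global vortex line through `y`
  obtain ⟨α, hα0, hα⟩ := vortexLineGlobal C v hP y
  -- the core
  obtain ⟨r, hr, δ, hδ, hcore⟩ := alone_core (w := fun x => v (-1) x 2) (ψ := ψ (-1)) hwan hψ1 hωc hgrad hω2 hy2 hωy
    hstruct hNoInt' hα0 hα
  refine ⟨r, hr, α, δ, hδ, hα0, fun s _ => hα s, fun y' hy' hd => ?_⟩
  obtain ⟨hy'2, hy'N⟩ : y' 2 = 0 ∧ v (-1) y' 2 = v (-1) 0 2 := hy'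
  exact hcore y' hy'2 (by simp only [hy'N, hyN]) hd

end Summit.NavierStokesRegularity.NavierStokesRegularity.Theorems.PoloidalWindowDoorPoloidalWindowRigidityLeafUniformHotRegularAlone

end
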